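import Summits.QuantumFields.YangMills.Theorems.BalabanUVNodesN06SectBStepUParKnit
import Summits.QuantumFields.YangMills.Theorems.BalabanUVNodesN06SectBQVarLawsKnit

/-!
# Balaban UV-stability nodes, N06 [B9] Sect. B — «K2-G-KNIT-FULL»: THE SECT.-B STEP AT THE KNIT TRANSPORTER WITH THE KNIT (3.80) VARIATIONS DISCHARGED —
# the knit class `C37KY` pinned to the coded-chain regularity `R := (bg9YC M_N(ℂ) G extraYPb x).Reg335 c35`, its three projections fed to dag-n06-l's
# `hQ80_knit ∕ hQL280_knit`; displayed: the knit Thm 3.11 unit `hunitA`, Thm 3.2 `h32`, the coded Thm 3.3 `h33`, the x-free numerics windows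

[B9] = T. Bałaban, *Propagators for lattice gauge theories in a background field*, Commun. Math. Phys. **99** (1985) 389–434 [`Balaban1985BackgroundPropagators`];
[B8] = T. Bałaban, *Averaging operations for lattice gauge theories*, Commun. Math. Phys. **98** (1985) 17–51 [`Balaban1985Averaging`]; [4] = [`Balaban1984PropagatorsII`].

statement-level skeleton of published theorems with citation tags; proofs where landed; nothing here is a claim about the Yang–Mills mass gap

THE PRINT.  Thm 3.4 p. 400 (Sect.-B step); (3.37) p. 396 (the class of the pair); (3.80)–(3.81) p. 406 (the variation of the averaging letter under `U ↦ U′U`, «|A| < α₁(Lʲη)⁻¹ on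
Bʲ(Λ_j)»); (3.19) p. 393 ([B8]'s composite contours); Thm 3.11 p. 416.

WHAT (seat dag-n06-c gen 26, after dag-n06-l's «P-Q80-knit» F3b `…N06SectBQVarLawsKnit` ✓p791877 and its shape check I.20685).  The companion file
`…N06SectBStepUParKnit` (`sectBStepUPar_knit_of_laws`) displays the pair's (3.80) variations `hQ80 ∕ hQL280` at the class `C37KY G x ιB R Cq CqK MK aK β₀`; dag-n06-l's
`hQ80_knit ∕ hQL280_knit` inhabit them for ANY class `C37` carrying three displayed laws `hC37R ∕ hC37A ∕ hC37ϱ`.  THIS FILE pins the knit class's regularity predicate to the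
coded chain's own currency `R x := fun α₀ U => (bg9YC M_N(ℂ) G extraYPb x).Reg335 c35 α₀ U` (threshold `aK := aInv`), derives the three laws from the class's projections
(§1: `hC37R_of_C37KY` ⇐ `regDatum_of_C37KY`; `hC37A_of_C37KY` ⇐ `cplx337_of_C37KY` + dag-n06-l's `B9SectBQVarLawsOfKernelY.endBlock_small_of_cplx337`, constant `cA := L⁻³`
since the class exponent is `β = L⁴α₁`; `hC37ϱ_of_C37KY` ⇐ `le_of_C37KY` under `3·L⁻³·β₀ ≦ ϱ′`), and assembles §2 ★★★ `sectBStepUPar_knit`: the Sect.-B step over the coded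
carrier at `(parA, parH) := (parKnitY, parSymY)`, `G[𝔮]` at the knit pair, class `C37KY`, `P := extraYPb` — with EVERY law the tree holds discharged; displayed remain the
GUARDED knit Thm 3.11 unit `hunitA` (dag-n06-j's family), the record's Thm 3.2 `h32`, the coded Thm 3.3 `h33`, the basis data, the knit faces `h𝔮 ∕ h𝔮s`, the x-free
numerics windows of [B8] Props 2∕5∕7 (`α₀′ ≦ α_Q`, `8α₀′ ≦ c₂′`, `K_pl·L⁴ < α₀′`, the `ϱ′ ∕ ϱ` window of `B9Eq380QknitVariationY`), the thresholds `MInv aInv aW mN`, and the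
free class constants `Cq CqK MK β₀` (`0 ≦ CqK`, `3·L⁻³·β₀ ≦ ϱ′`).

HONEST SCOPE.  Instantiation ∕ bookkeeping of landed theorems; conditional on `hunitA`, `h32`, `h33` and the numerics; a HELPER toward the knit certificate's `hBK` (class
re-key `C37GY → C37KY` is dag-n06-d's ∕ node00-def-Y's call); the knit (3.58) ((K1), dag-n06-l) is NOT used here — it enters only the coded→record transfer
`hclass_C37KY_on`; NOT the discharge of any N06 obligation; count-neutral; nothing continuum ∕ OS ∕ mass gap ∕ Clay.  Cell `pub-ymgap` (HUMAN RULING D-0062), Track A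
node N06 [B9], 2026-08-30.
-/

noncomputable section

namespace Summit.QuantumFields.YangMills.BalabanUVNodes.N06SectBStepUParKnitFull

open scoped Matrix Matrix.Norms.L2Operator
open Literature.MathematicalPhysics.QuantumFieldTheory.Balaban1983to89
open Literature.MathematicalPhysics.QuantumFieldTheory.Balaban1983to89.Node00 (SiteY BlkY FBondY IBondY CfgY SiteParY GAQY GpY XY deltaAQY deltaPrimeAY parSymY parBY)
open Literature.MathematicalPhysics.QuantumFieldTheory.Balaban1983to89.Node00.OpsYQLetter (adjTrY)
open Literature.MathematicalPhysics.QuantumFieldTheory.Balaban1983to89.B6Ineq2142KLevelV1 (β)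
open Literature.MathematicalPhysics.QuantumFieldTheory.Balaban1983to89.B6GlobalChartV1 (PV)
open Literature.MathematicalPhysics.QuantumFieldTheory.Balaban1983to89.B6KLevelCensusIndexV1 (KIdx kGeo)
open Literature.MathematicalPhysics.QuantumFieldTheory.Balaban1983to89.B6RandomWalk (HasMajorant Ineq261)
open Literature.MathematicalPhysics.QuantumFieldTheory.Balaban1983to89.B6RandomWalkL2 (HasL2Majorant)
open Literature.MathematicalPhysics.QuantumFieldTheory.Balaban1983to89.B9Thm34Ext (toB6)
open Literature.MathematicalPhysics.QuantumFieldTheory.Balaban1983to89.B9PinMembersKLevelV1 (MemberY geo9Y)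
open Literature.MathematicalPhysics.QuantumFieldTheory.Balaban1983to89.B9BackgroundsKLevelV1P (bg9KP)
open Literature.MathematicalPhysics.QuantumFieldTheory.Balaban1983to89.B9SectBCodedClassR (RegExtraY bg9YC extraYPb)
open Literature.MathematicalPhysics.QuantumFieldTheory.Balaban1983to89.B9Eq360DeltaPrimeAY (AfldY)
open Literature.MathematicalPhysics.QuantumFieldTheory.Balaban1983to89.B9SectBGpLettersY (GVal blkC)
open Literature.MathematicalPhysics.QuantumFieldTheory.Balaban1983to89.B9SectBGpFrameCodedYR (codingYx)
open Literature.MathematicalPhysics.QuantumFieldTheory.Balaban1983to89.B9SectBCodedReadingsUR (KACU)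
open Literature.MathematicalPhysics.QuantumFieldTheory.Balaban1983to89.B9SectBCodedReadingsUParH (KSCUPar SectBStepUPar)
open Literature.MathematicalPhysics.QuantumFieldTheory.Balaban1983to89.B9SectBKerFrameCodedYR (CinvY)
open Literature.MathematicalPhysics.QuantumFieldTheory.Balaban1983to89.B9RWSumsReadsNbr (nbr)
open Literature.MathematicalPhysics.QuantumFieldTheory.Balaban1983to89.B9Eq340TaxiContourLocalityY (rLB)
open Literature.MathematicalPhysics.QuantumFieldTheory.Balaban1983to89.B9SectBCodedClassKnitY (C37KY regDatum_of_C37KY cplx337_of_C37KY le_of_C37KY)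
open Literature.MathematicalPhysics.QuantumFieldTheory.Balaban1983to89.B9SectBQVarLawsOfKernelY (endBlock_small_of_cplx337)
open Literature.MathematicalPhysics.QuantumFieldTheory.Balaban1983to89.B7Prop2Explicit (unitaryUnits AvgClosed C0 c2')
open Literature.MathematicalPhysics.QuantumFieldTheory.Balaban1983to89.B7Prop3Flat (c3)
open Literature.MathematicalPhysics.QuantumFieldTheory.Balaban1983to89.B7Prop5CplxLevels (epsCplx tauCplx)
open Literature.MathematicalPhysics.QuantumFieldTheory.Balaban1983to89.B5Eq118OneStroke (iterBlockOf)
open Literature.MathematicalPhysics.QuantumFieldTheory.Balaban1983to89.B9Eq316AveragingTransposeZd (alphaQ)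
open Literature.MathematicalPhysics.QuantumFieldTheory.Balaban1983to89.B9Eq3115KnitLetterY (QknitY)
open Literature.MathematicalPhysics.QuantumFieldTheory.Balaban1983to89.B9C2FormBoxRegimeY (Kpl)
open Literature.MathematicalPhysics.QuantumFieldTheory.Balaban1983to89.B9B8KnitColumnFlatness (windows_of_alphaQ)
open Literature.MathematicalPhysics.QuantumFieldTheory.Balaban1983to89.B9B8AveragingJunction (parKnitY)
open Summit.QuantumFields.YangMills.BalabanUVNodes.N06SectBQVarLawsKnit (hQ80_knit hQL280_knit)
open Summit.QuantumFields.YangMills.BalabanUVNodes.N06SectBStepUParKnit (sectBStepUPar_knit_of_laws)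

variable {d ℓ : ℕ} {hd : 1 ≤ d + 1} {hL : Odd (ℓ + 1) ∧ 1 < ℓ + 1} {b₀ b₁ : ℝ}
variable {N : ℕ} [Nonempty (Fin N)] {ι : Type} [Fintype ι] [DecidableEq ι]
variable {Mstar : ℕ} {J : Type} (f : J → MemberY d ℓ hd hL b₀ b₁ Mstar)
  [∀ x : MemberY d ℓ hd hL b₀ b₁ Mstar, Fintype (geo9Y x).Site]
  [instDS : ∀ x : MemberY d ℓ hd hL b₀ b₁ Mstar, DecidableEq (geo9Y x).Site] [instNE : ∀ x : MemberY d ℓ hd hL b₀ b₁ Mstar, Nonempty (geo9Y x).Site]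
  (c35 : ℝ) (G : Subgroup (Matrix (Fin N) (Fin N) ℂ)ˣ) (P : RegExtraY d ℓ hd hL b₀ b₁ Mstar (Matrix (Fin N) (Fin N) ℂ))
  (𝔮 : ∀ j : J, CfgY (Matrix (Fin N) (Fin N) ℂ) (f j).toKIdx → ((FBondY (f j).toKIdx → Matrix (Fin N) (Fin N) ℂ) →ₗ[ℂ] (IBondY (f j).toKIdx → Matrix (Fin N) (Fin N) ℂ)))
  (𝔮s : ∀ j : J, CfgY (Matrix (Fin N) (Fin N) ℂ) (f j).toKIdx → ((IBondY (f j).toKIdx → Matrix (Fin N) (Fin N) ℂ) →ₗ[ℂ] (FBondY (f j).toKIdx → Matrix (Fin N) (Fin N) ℂ)))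
  (b : Module.Basis ι ℝ (Matrix (Fin N) (Fin N) ℂ)) (ιB : ∀ j : J, BlkY (f j).toKIdx → IBondY (f j).toKIdx)
  (C38 : ∀ j : J, ℝ → CfgY (Matrix (Fin N) (Fin N) ℂ) (f j).toKIdx → AfldY (Matrix (Fin N) (Fin N) ℂ) (f j).toKIdx → Prop)
  (Cq CqK MK aInv β₀ : ℝ)

/-! ## §1 The three displayed laws of dag-n06-l's `hQ80_knit` at the knit class `C37KY` pinned to the coded regularity -/

section Adapters

omit [Nonempty (Fin N)] [Fintype ι] [DecidableEq ι] [∀ x : MemberY d ℓ hd hL b₀ b₁ Mstar, Fintype (geo9Y x).Site] instDS instNE in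
/-- `hC37R` at `C37 := C37KY … (R := (bg9YC …).Reg335 c35) … aInv …` — the (3.35) datum of the class (`regDatum_of_C37KY`, the threshold `MK ≦ M` dropped).
[cite: Balaban1985BackgroundPropagators, (3.35) p.396, (3.37) p.396, bookkeeping] -/
theorem hC37R_of_C37KY :
    ∀ (j : J) (β' : ℝ) (U : CfgY (Matrix (Fin N) (Fin N) ℂ) (f j).toKIdx) (a : AfldY (Matrix (Fin N) (Fin N) ℂ) (f j).toKIdx),
      C37KY G (f j) (ιB j) (fun α₀ U => (bg9YC (Matrix (Fin N) (Fin N) ℂ) G P (f j)).Reg335 c35 α₀ U) Cq CqK MK aInv β₀ β' U a →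
        ∃ α₀ : ℝ, 0 < α₀ ∧ (geo9Y (f j)).M * α₀ ≤ aInv ∧ (bg9YC (Matrix (Fin N) (Fin N) ℂ) G P (f j)).Reg335 c35 α₀ U := by
  intro j β' U a h
  obtain ⟨α₀, hα₀, -, hMa, hR⟩ := regDatum_of_C37KY G (f j) (ιB j) _ h
  exact ⟨α₀, hα₀, hMa, hR⟩

omit [Nonempty (Fin N)] [Fintype ι] [DecidableEq ι] [∀ x : MemberY d ℓ hd hL b₀ b₁ Mstar, Fintype (geo9Y x).Site] instDS instNE in
/-- `hC37A` at `C37 := C37KY …` with `cA := L⁻³`: on the two end blocks of every index bond `κ`, `Lʲ⁽κ⁾η·‖a_μ(x)‖ ≦ L⁻³·β` — from the class's raw (3.37) datum (`β = L⁴α₁`,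
`a ∈ Cplx337(α₁)`) by dag-n06-l's `endBlock_small_of_cplx337` (`≦ L·α₁`). [cite: Balaban1985BackgroundPropagators, (3.37) p.396, p.406 (before (3.79)); Balaban1984PropagatorsII, (2.2)–(2.4) p.224] -/
theorem hC37A_of_C37KY (R : ∀ j : J, ℝ → CfgY (Matrix (Fin N) (Fin N) ℂ) (f j).toKIdx → Prop) :
    ∀ (j : J) (β' : ℝ) (U : CfgY (Matrix (Fin N) (Fin N) ℂ) (f j).toKIdx) (a : AfldY (Matrix (Fin N) (Fin N) ℂ) (f j).toKIdx),
      C37KY G (f j) (ιB j) (R j) Cq CqK MK aInv β₀ β' U a →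
        ∀ (κ : IBondY (f j).toKIdx) (μ : Fin (d + 1)) (x : Site (PV d ℓ (f j).toKIdx.m (f j).toKIdx.K hd hL) 0),
          iterBlockOf (κ.1.1 : ℕ) x = κ.1.2.src ∨ iterBlockOf (κ.1.1 : ℕ) x = κ.1.2.tgt →
            (((ℓ + 1 : ℕ) : ℝ)) ^ (κ.1.1 : ℕ) * (kGeo (f j).toKIdx).eta * ‖a μ x‖ ≤ ((((ℓ + 1 : ℕ) : ℝ)) ^ 3)⁻¹ * β' := by
  intro j β' U a h κ μ x hx
  obtain ⟨α₁, _, _, hβ, hcl⟩ := cplx337_of_C37KY G (f j) (ιB j) _ h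
  refine (endBlock_small_of_cplx337 (f j).toKIdx hcl κ μ x hx).trans (le_of_eq ?_)
  have hL0 : (0 : ℝ) < (((ℓ + 1 : ℕ) : ℝ)) := by positivity
  rw [hβ]
  push_cast
  field_simp

omit [Nonempty (Fin N)] [Fintype ι] [DecidableEq ι] [∀ x : MemberY d ℓ hd hL b₀ b₁ Mstar, Fintype (geo9Y x).Site] instDS instNE in
/-- `hC37ϱ` at `C37 := C37KY …` under `3·L⁻³·β₀ ≦ ϱ′`: `3·(L⁻³·β) ≦ ϱ′` for every class pair (`le_of_C37KY`: `0 < β ≦ β₀`).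
[cite: Balaban1985BackgroundPropagators, (3.37) p.396, p.406, bookkeeping] -/
theorem hC37ϱ_of_C37KY (R : ∀ j : J, ℝ → CfgY (Matrix (Fin N) (Fin N) ℂ) (f j).toKIdx → Prop) {ϱ' : ℝ}
    (hβ₀ : 3 * (((((ℓ + 1 : ℕ) : ℝ)) ^ 3)⁻¹ * β₀) ≤ ϱ') :
    ∀ (j : J) (β' : ℝ) (U : CfgY (Matrix (Fin N) (Fin N) ℂ) (f j).toKIdx) (a : AfldY (Matrix (Fin N) (Fin N) ℂ) (f j).toKIdx),
      C37KY G (f j) (ιB j) (R j) Cq CqK MK aInv β₀ β' U a → 3 * (((((ℓ + 1 : ℕ) : ℝ)) ^ 3)⁻¹ * β') ≤ ϱ' := by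
  intro j β' U a h
  obtain ⟨-, hle⟩ := le_of_C37KY G (f j) (ιB j) _ h
  have hL : (0 : ℝ) ≤ ((((ℓ + 1 : ℕ) : ℝ)) ^ 3)⁻¹ := by positivity
  nlinarith [mul_le_mul_of_nonneg_left hle hL]

end Adapters

/-! ## §2 ★★★ The Sect.-B step at the knit transporter with the knit (3.80) variations discharged -/

section Knit

/-- ★★★ **THE TWO-TRANSPORTER SECT.-B STEP OVER THE CODED CARRIER AT `(parA, parH) := (parKnitY, parSymY)`, `G[𝔮]` AT THE KNIT PAIR, CLASS `C37KY` PINNED TO THE CODED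
REGULARITY, `P := extraYPb`, `𝔸 = M_N(ℂ)` — EVERY LAW THE TREE HOLDS DISCHARGED**: `sectBStepUPar_knit_of_laws` (companion file: `hsym hparG hunitG hunitXG hC37 hparC hC37G hQ15
hQL2 hreg335P hplaq (d261,h261)` discharged) with, in addition, `hQ80 := N06SectBQVarLawsKnit.hQ80_knit` and `hQL280 := N06SectBQVarLawsKnit.hQL280_knit` (dag-n06-l, [B8] Prop. 7)
fed by §1's three projections of the class (`cA := L⁻³`).  DISPLAYED: `hι`, `hGa hGU`, basis data `M₂ hrepr hcR hcL`, knit faces `h𝔮 h𝔮s`, the numerics windows (`hMInv haInv haW hc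
hRP hα' hαQ hα8 hKpl`, `hϱ' hϱ hsmall' hc₃' hϱ'1 hE hdX hsmall hc₃`, `hMd hMr mN hnbr`), the class constants (`hCqK`, `hβ₀ : 3·L⁻³·β₀ ≦ ϱ′`), the GUARDED knit Thm 3.11 unit
`hunitA`, `hb₁`, the record's Thm 3.2 `h32`, the coded Thm 3.3 `h33`.
[cite: Balaban1985BackgroundPropagators, Thm 3.4 p.400, Sect. B pp.400–407, (3.19) p.393, (3.35)–(3.37) p.396, (3.80)–(3.81) p.406, Thms 3.1–3.3 pp.397–399, Thm 3.11 p.416; Balaban1985Averaging, Prop. 2 p.26, Prop. 7 p.43; Balaban1984PropagatorsII, Lemma 2.1 p.234, (2.51) p.232] -/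
theorem sectBStepUPar_knit [NormOneClass (Matrix (Fin N) (Fin N) ℂ)] [FiniteDimensional ℝ (Matrix (Fin N) (Fin N) ℂ)]
    (hι : ∀ (j : J) (s : BlkY (f j).toKIdx), β (f j).toKIdx.hN (f j).toKIdx.D (f j).toKIdx.hk (ιB j s) = s)
    (hGa : AvgClosed (d + 1) (ℓ + 1) G) (hGU : G ≤ unitaryUnits (Matrix (Fin N) (Fin N) ℂ))
    (M₂ : ℝ) (hM₂ : 0 ≤ M₂) (hrepr : ∀ (v : Matrix (Fin N) (Fin N) ℂ) (j : ι), |b.repr v j| ≤ M₂ * ‖v‖) (hcR : 0 < M₂ * ∑ j, ‖b j‖)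
    (hcL : 0 < Real.sqrt (Fintype.card ι) * M₂ * ∑ j, ‖b j‖)
    (h𝔮 : ∀ (j : J) (U : CfgY (Matrix (Fin N) (Fin N) ℂ) (f j).toKIdx), 𝔮 j U = QknitY (f j).toKIdx U)
    (h𝔮s : ∀ (j : J) (U : CfgY (Matrix (Fin N) (Fin N) ℂ) (f j).toKIdx), 𝔮s j U = adjTrY (QknitY (f j).toKIdx U))
    (hCqK : 0 ≤ CqK)
    (MInv aW : ℝ) (hMInv : 0 < MInv) (haInv : 0 < aInv) (haW : 0 < aW) {c₀ : ℝ} (hc : c₀ ≤ 10)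
    (hRP : ∀ (j : J) (α₀ : ℝ) (U : CfgY (Matrix (Fin N) (Fin N) ℂ) (f j).toKIdx),
      (bg9YC (Matrix (Fin N) (Fin N) ℂ) G (extraYPb (Matrix (Fin N) (Fin N) ℂ) G) (f j)).Reg335 c35 α₀ U →
        (bg9KP (Matrix (Fin N) (Fin N) ℂ) G (f j).toKIdx).Reg335 c₀ α₀ U)
    {α₀' : ℝ} (hα' : 0 < α₀') (hαQ : α₀' ≤ alphaQ (d + 1) (ℓ + 1)) (hα8 : 8 * α₀' ≤ c2' (d + 1) (ℓ + 1))
    (hKpl : ∀ (j : J) (a : ℝ), 0 ≤ a → a ≤ aInv → Kpl (f j).toKIdx a * (kGeo (f j).toKIdx).L ^ 4 < α₀')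
    -- the x-free Prop-7∕Prop-5 window of `B9Eq380QknitVariationY` (dag-n06-l)
    {ϱ' ϱ : ℝ} (hϱ' : 0 < ϱ') (hϱ : 0 < ϱ)
    (hsmall' : Real.exp (4 * (800 * (((d + 1 : ℕ) : ℝ) + 1) ^ 2 * (((d + 1 : ℕ) : ℝ) + 4)) * α₀')
      * (1 + 8 * (131072 * (((d + 1 : ℕ) : ℝ) + 1) ^ 2) * ϱ') ≤ 2)
    (hc₃' : 2 * ϱ' ≤ c3 (d + 1) (ℓ + 1)) (hϱ'1 : 409600 * (((d + 1 : ℕ) : ℝ) + 1) ^ 2 * ϱ' ≤ 1)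
    (hE : epsCplx (d + 1) (ℓ + 1) ϱ' 0 ≤ 1 / 16)
    (hdX : ((d + 1 : ℕ) : ℝ) * (epsCplx (d + 1) (ℓ + 1) ϱ' 0 + tauCplx (d + 1) (ℓ + 1) α₀' 0 ϱ' 0) ≤ 1 / 16)
    (hsmall : Real.exp (4480 * (((d + 1 : ℕ) : ℝ) + 1) ^ 2 * (((d + 1 : ℕ) : ℝ) + 4) * α₀' + 240000 * (((d + 1 : ℕ) : ℝ) + 1) ^ 3 * ϱ')
      * (1 + 8 * (2097152 * (((d + 1 : ℕ) : ℝ) + 1) ^ 2) * ϱ) ≤ 2)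
    (hc₃ : 2 * ϱ ≤ c3 (d + 1) (ℓ + 1) / 4)
    (hβ₀ : 3 * (((((ℓ + 1 : ℕ) : ℝ)) ^ 3)⁻¹ * β₀) ≤ ϱ')
    (hunitA : ∀ j (α₀ : ℝ) (U : CfgY (Matrix (Fin N) (Fin N) ℂ) (f j).toKIdx), MInv ≤ (geo9Y (f j)).M → 0 < α₀ → (geo9Y (f j)).M * α₀ ≤ aInv →
      (bg9YC (Matrix (Fin N) (Fin N) ℂ) G (extraYPb (Matrix (Fin N) (Fin N) ℂ) G) (f j)).Reg335 c35 α₀ U →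
      IsUnit (deltaAQY (f j).toKIdx (𝔮 j) (𝔮s j) (parKnitY (f j).toKIdx) (GpY (f j).toKIdx (parKnitY (f j).toKIdx)) U)) (hb₁ : 0 ≤ b₁)
    (hMd : 2 * ((d : ℝ) + 1) < MInv) (mN : ℕ) (hnbr : ∀ (j : J) (y' : IBondY (f j).toKIdx), (nbr (geo9Y (f j)) (2 * ((d : ℝ) + 1)) y').card ≤ mN)
    (hMr : rLB d ℓ + 1 < MInv)
    (h32 : B9.Thm32Printed (d + 1) c35 (fun j => geo9Y (f j)) (fun j => bg9YC (Matrix (Fin N) (Fin N) ℂ) G (extraYPb (Matrix (Fin N) (Fin N) ℂ) G) (f j))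
      (CinvY (extraYPb (Matrix (Fin N) (Fin N) ℂ) G) f G (fun j => parKnitY (f j).toKIdx)))
    (h33 : B9.Thm33Printed c35 (fun j => geo9Y (f j))
      (fun j => (codingYx (extraYPb (Matrix (Fin N) (Fin N) ℂ) G) G (f j)
        (C37KY G (f j) (ιB j) (fun α₀ U => (bg9YC (Matrix (Fin N) (Fin N) ℂ) G (extraYPb (Matrix (Fin N) (Fin N) ℂ) G) (f j)).Reg335 c35 α₀ U) Cq CqK MK aInv β₀) (C38 j)).bg)
      (fun j => KSCUPar (extraYPb (Matrix (Fin N) (Fin N) ℂ) G) G (f j) (parKnitY (f j).toKIdx) (parSymY (f j).toKIdx)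
        (C37KY G (f j) (ιB j) (fun α₀ U => (bg9YC (Matrix (Fin N) (Fin N) ℂ) G (extraYPb (Matrix (Fin N) (Fin N) ℂ) G) (f j)).Reg335 c35 α₀ U) Cq CqK MK aInv β₀) (C38 j))
      (fun j => KACU (extraYPb (Matrix (Fin N) (Fin N) ℂ) G) G (f j)
        (GAQY (f j).toKIdx (𝔮 j) (𝔮s j) (parKnitY (f j).toKIdx) (GpY (f j).toKIdx (parKnitY (f j).toKIdx))) (parBY (f j).toKIdx)
        (C37KY G (f j) (ιB j) (fun α₀ U => (bg9YC (Matrix (Fin N) (Fin N) ℂ) G (extraYPb (Matrix (Fin N) (Fin N) ℂ) G) (f j)).Reg335 c35 α₀ U) Cq CqK MK aInv β₀) (C38 j))) :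
    SectBStepUPar (extraYPb (Matrix (Fin N) (Fin N) ℂ) G) f (d + 1) c35 G b (fun j => parKnitY (f j).toKIdx) (fun j => parSymY (f j).toKIdx)
      (fun j => GAQY (f j).toKIdx (𝔮 j) (𝔮s j) (parKnitY (f j).toKIdx) (GpY (f j).toKIdx (parKnitY (f j).toKIdx)))
      (fun j => parBY (f j).toKIdx)
      (fun j => C37KY G (f j) (ιB j) (fun α₀ U => (bg9YC (Matrix (Fin N) (Fin N) ℂ) G (extraYPb (Matrix (Fin N) (Fin N) ℂ) G) (f j)).Reg335 c35 α₀ U) Cq CqK MK aInv β₀)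
      C38 (CinvY (extraYPb (Matrix (Fin N) (Fin N) ℂ) G) f G (fun j => parKnitY (f j).toKIdx)) := by
  obtain ⟨hα3, -, -⟩ := windows_of_alphaQ (D := d + 1) hL.2 (Nat.succ_pos d) hα' hαQ
  have hcA : (0 : ℝ) ≤ ((((ℓ + 1 : ℕ) : ℝ)) ^ 3)⁻¹ := by positivity
  -- the three displayed laws of `hQ80_knit` at the pinned knit class
  have hC37R := hC37R_of_C37KY f c35 G (extraYPb (Matrix (Fin N) (Fin N) ℂ) G) ιB Cq CqK MK aInv β₀
  have hC37A := hC37A_of_C37KY f G ιB Cq CqK MK aInv β₀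
    (fun j α₀ U => (bg9YC (Matrix (Fin N) (Fin N) ℂ) G (extraYPb (Matrix (Fin N) (Fin N) ℂ) G) (f j)).Reg335 c35 α₀ U)
  have hC37ϱ := hC37ϱ_of_C37KY f G ιB Cq CqK MK aInv β₀
    (fun j α₀ U => (bg9YC (Matrix (Fin N) (Fin N) ℂ) G (extraYPb (Matrix (Fin N) (Fin N) ℂ) G) (f j)).Reg335 c35 α₀ U) hβ₀
  have hQ80 := hQ80_knit (Mstar := Mstar) (extraYPb (Matrix (Fin N) (Fin N) ℂ) G) f c35 G 𝔮 𝔮s b ιB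
    (fun j => C37KY G (f j) (ιB j) (fun α₀ U => (bg9YC (Matrix (Fin N) (Fin N) ℂ) G (extraYPb (Matrix (Fin N) (Fin N) ℂ) G) (f j)).Reg335 c35 α₀ U) Cq CqK MK aInv β₀)
    hGU hι hM₂ hrepr h𝔮 h𝔮s hc hRP hα' hα3 hα8 hKpl hϱ' hϱ hsmall' hc₃' hϱ'1 hE hdX hsmall hc₃ hcA hC37R hC37A hC37ϱ
  have hQL280 := hQL280_knit (Mstar := Mstar) (extraYPb (Matrix (Fin N) (Fin N) ℂ) G) f c35 G 𝔮 𝔮s b ιB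
    (fun j => C37KY G (f j) (ιB j) (fun α₀ U => (bg9YC (Matrix (Fin N) (Fin N) ℂ) G (extraYPb (Matrix (Fin N) (Fin N) ℂ) G) (f j)).Reg335 c35 α₀ U) Cq CqK MK aInv β₀)
    hGU hι hM₂ hrepr h𝔮 h𝔮s hc hRP hα' hα3 hα8 hKpl hϱ' hϱ hsmall' hc₃' hϱ'1 hE hdX hsmall hc₃ hcA hC37R hC37A hC37ϱ
  have hb0 : 0 ≤ ∑ j, ‖b j‖ := Finset.sum_nonneg fun _ _ => norm_nonneg _
  have hcF : 0 ≤ (M₂ * ∑ j, ‖b j‖) * ((N : ℝ) ^ 4 * (9 / (2 * ϱ') * (2 * ((d : ℝ) + 1))) * ((((ℓ + 1 : ℕ) : ℝ)) ^ 3)⁻¹) *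
      Real.exp ((ℓ : ℝ) + 4) := by positivity
  have hcF2 : 0 ≤ (Real.sqrt (Fintype.card ι) * M₂ * ∑ j, ‖b j‖) * ((N : ℝ) ^ 4 * (9 / (2 * ϱ') * (2 * ((d : ℝ) + 1))) * ((((ℓ + 1 : ℕ) : ℝ)) ^ 3)⁻¹) *
      Real.exp ((ℓ : ℝ) + 4) := by positivity
  exact sectBStepUPar_knit_of_laws f c35 G 𝔮 𝔮s b ιB C38
    (fun j α₀ U => (bg9YC (Matrix (Fin N) (Fin N) ℂ) G (extraYPb (Matrix (Fin N) (Fin N) ℂ) G) (f j)).Reg335 c35 α₀ U) Cq CqK MK aInv β₀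
    hι hGa hGU M₂ hM₂ hrepr hcR hcL h𝔮 h𝔮s hCqK MInv aInv aW hMInv haInv haW hc hRP hα' hαQ hKpl hunitA hb₁ _ hcF hQ80 _ hcF2 hQL280
    hMd mN hnbr hMr h32 h33

end Knit

end Summit.QuantumFields.YangMills.BalabanUVNodes.N06SectBStepUParKnitFull

end
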